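import Literature.AlgebraicTopology.SingularHomology.BoundaryClassGenerator
import HarnessLib

/-!
# The boundary of a relative fundamental class is natural under open embeddings (locality of `∂z|ₚ`)

E. H. Spanier, *Algebraic Topology* (1981), Ch. 6 §3, Cor. 10 and A. Hatcher, *Algebraic Topology*
(2002), p. 254: for a compact manifold with boundary `W` and a relative class `z ∈ Hₙ₊₁(W, ∂W)`,
the local image `(∂z)|ₚ ∈ Hₙ(∂W | p)` of the boundary `∂z` at `p ∈ ∂W` — the local orientation of
the boundary induced by `z` (`boundaryOrientation`, `…BoundaryClassGenerator`). The tree's proof of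
Cor. 6.3.10 (`…BoundaryTransfer`, `…BoundaryClassGenerator`) computes `(∂z)|ₚ` in a **half chart**
`c` at `p` (`HalfChart`): `j_B((∂z)|ₚ) = Φ(z|_{N⁺})` where `N⁺` is the open core of the chart,
`Φ = (restriction to p) ∘ ∂` and `z|_{N⁺}` is determined by the local image `z|_y` at the centre
`y` of the core (`HalfChart.Φ_coreClass`, `isIso_restrictToPoint_center`, `isIso_map_jB`).

This file records the consequence that **`(∂z)|ₚ` depends only on `z` near `p`, naturally in open
embeddings of pairs**. For an open embedding `j : X' → X` with `j⁻¹(B) = B'` and a half chart `c'`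
of `(X', B')` at `b`:

* `HalfChart.pushforward` — the half chart `j_* c'` of `(X, B)` at `j b` (same model, same size),
  with `core (j_* c') = j(core c')`, `center (j_* c') = j (center c')`;
* `HalfChart.transferAt c' : Hₙ₊₁(X' | center c') → Hₙ(B' | b)` — the composite
  `j_B'⁻¹ ∘ Φ' ∘ res⁻¹` of the chart's isomorphisms (`X'` Hausdorff, `n ≠ 0` not even needed for
  the definition), carrying `z'|_y` to `(∂z')|_b` for relative classes `z'` of `(X', B')`;
* `HalfChart.toLocal_δ_eq_map_transferAt` — **naturality**: for every `z ∈ Hₙ₊₁(X, B; M)` whose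
  local image at `j (center c')` is `j_* ζ`, `ζ ∈ Hₙ₊₁(X' | center c')`, one has
  `(∂z)|_{j b} = (j|_{B'})_* (transferAt c' ζ)`;
* `HalfChart.toLocal_δ_eq_of_two_embeddings` — hence for two open embeddings `j₁ : X' → X₁`,
  `j₂ : X' → X₂` and classes `zᵢ ∈ Hₙ₊₁(Xᵢ, Bᵢ)` with a common local image `ζ` at the centre, the
  boundary local classes `(∂zᵢ)|_{jᵢ b}` are the images of one class `β ∈ Hₙ(B' | b)`;
* `toLocal_δ_eq_of_two_embeddings_manifold` — the form for topological manifolds with boundary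
  (`B = ∂W`, half charts from `exists_halfChart_top`).

This is the locality behind "the boundary orientation of `W₁ ♮ W₂` restricts to those of `W₁`,
`W₂`" (Kervaire–Milnor 1963, §2: "`bW = bW₁ # bW₂`" as oriented manifolds). Everything is proved;
nothing is asserted.

## References

* E. H. Spanier, *Algebraic Topology*, Springer 1981, Ch. 6 §3 Cor. 10. [Spanier1981]
* A. Hatcher, *Algebraic Topology*, CUP 2002, §3.3 p. 252 (half-space charts), p. 254, §2.1
  (naturality of `∂`). [HatcherAT2002]
-/

noncomputable section

open CategoryTheory Limits Topology Metric Set Function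
open scoped Manifold

universe u v

namespace Literature.AlgebraicTopology.SingularHomology

variable (R : Type v) [CommRing R] (M : Type v) [AddCommGroup M] [Module R M]

/-! ### Elementwise naturality of `toLocal` -/

section ToLocalNat

variable {P Z : Type u} [TopologicalSpace P] [TopologicalSpace Z]

/-- Naturality of `Hₖ(P) → Hₖ(P | p)` for a map of pairs `(P, P ∖ p) → (Z, Z ∖ z)`, elementwise
(Hatcher 2002, §2.1, naturality of the sequence of the pair). [cite: HatcherAT2002, §2.1 (naturality)] -/
theorem singularHomology.toLocal_map_apply' (f : C(P, Z)) (p : P) (z : Z)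
    (h : MapsTo f ({p}ᶜ : Set P) ({z}ᶜ : Set Z)) (k : ℕ) (a : singularHomology R M P k) :
    singularHomology.toLocal R M z k (singularHomology.map R M f k a) =
      relativeSingularHomology.map R M f h k (singularHomology.toLocal R M p k a) := by
  change (singularHomology.map R M f k ≫ relativeSingularHomology.ofAbsolute R M Z {z}ᶜ k) a =
    (relativeSingularHomology.ofAbsolute R M P {p}ᶜ k ≫ relativeSingularHomology.map R M f h k) a
  rw [relativeSingularHomology.ofAbsolute_comp_map]

end ToLocalNat

/-! ### An open embedding of pairs and its restrictions -/

section EmbeddingOfPairs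

variable {X' X : Type u} [TopologicalSpace X'] [TopologicalSpace X]

/-- A continuous inverse of an (injective) map `j` on its range (junk off the range). [folklore] -/
def embInv [Nonempty X'] (j : X' → X) (x : X) : X' := Function.invFun j x

omit [TopologicalSpace X'] [TopologicalSpace X] in
/-- `embInv j (j x') = x'` for `j` injective. [folklore] -/
@[simp] theorem embInv_apply [Nonempty X'] {j : X' → X} (hj : Injective j) (x' : X') :
    embInv j (j x') = x' :=
  Function.leftInverse_invFun hj x'

/-- `embInv j` is continuous on the range of an embedding `j`. [folklore] -/
theorem continuousOn_embInv [Nonempty X'] {j : X' → X} (hj : IsEmbedding j) :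
    ContinuousOn (embInv j) (range j) := by
  rw [continuousOn_iff_continuous_restrict]
  have : (range j).restrict (embInv j) = fun w => hj.toHomeomorph.symm w := by
    funext w
    obtain ⟨p, hp⟩ := w.2
    have hw : w = hj.toHomeomorph p :=
      Subtype.ext (by rw [hj.toHomeomorph_apply_coe]; exact hp.symm)
    rw [hw, Homeomorph.symm_apply_apply]
    show embInv j (hj.toHomeomorph p : X) = p
    rw [hj.toHomeomorph_apply_coe, embInv_apply hj.injective]
  rw [this]
  exact hj.toHomeomorph.symm.continuous

/-- The restriction `↥B' → ↥B` of a map `j` with `j(B') ⊆ B`. [folklore] -/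
abbrev bdryRestrict {B' : Set X'} {B : Set X} {j : X' → X} (hj : Continuous j)
    (hB : ∀ x', x' ∈ B' ↔ j x' ∈ B) : C(↥B', ↥B) :=
  subsetRestrict ⟨j, hj⟩ (fun x' hx' => (hB x').1 hx')

/-- The restriction of an injective `j` to the boundaries is a map of pairs away from base
points. [folklore] -/
theorem mapsTo_bdryRestrict {B' : Set X'} {B : Set X} {j : X' → X} (hjc : Continuous j)
    (hji : Injective j) (hB : ∀ x', x' ∈ B' ↔ j x' ∈ B) {b : X'} (hbB : b ∈ B') :
    MapsTo (bdryRestrict hjc hB) ({(⟨b, hbB⟩ : ↥B')}ᶜ : Set _)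
      ({(⟨j b, (hB b).1 hbB⟩ : ↥B)}ᶜ : Set _) :=
  fun _ hx h' => hx (Subtype.ext (hji (congrArg Subtype.val h')))

end EmbeddingOfPairs

/-! ### Pushing a half chart forward along an open embedding of pairs -/

namespace HalfChart

variable {X' X : Type u} [TopologicalSpace X'] [TopologicalSpace X]
variable {B' : Set X'} {B : Set X} {b : X'} {F : Type} [NormedAddCommGroup F] [NormedSpace ℝ F]
  {h : ℝ}

section Pushforward

variable [Nonempty X'] (c' : HalfChart B' b F h)

/-- **The pushed-forward half chart** `j_* c'` of `(X, B)` at `j b`: the chart `c'.e ∘ j⁻¹` on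
`j(source)`, for an open embedding `j : X' → X` with `j⁻¹(B) = B'` (Hatcher 2002, §3.3 p. 252:
half-space charts are transported along homeomorphisms onto open subsets). [cite: HatcherAT2002, §3.3 p. 252] -/
def pushforward {j : X' → X} (hj : IsOpenEmbedding j) (hB : ∀ x', x' ∈ B' ↔ j x' ∈ B) :
    HalfChart B (j b) F h where
  e :=
    { toFun := fun x => c'.e (embInv j x)
      invFun := fun v => j (c'.e.symm v)
      source := j '' c'.e.source
      target := c'.e.target
      map_source' := by
        rintro _ ⟨x', hx', rfl⟩
        rw [embInv_apply hj.injective]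
        exact c'.e.map_source hx'
      map_target' := fun v hv => ⟨c'.e.symm v, c'.e.map_target hv, rfl⟩
      left_inv' := by
        rintro _ ⟨x', hx', rfl⟩
        rw [embInv_apply hj.injective, c'.e.left_inv hx']
      right_inv' := fun v hv => by
        rw [embInv_apply hj.injective]
        exact c'.e.right_inv hv }
  isOpen_source := hj.isOpenMap _ c'.isOpen_source
  continuousOn := by
    change ContinuousOn (fun x => c'.e (embInv j x)) (j '' c'.e.source)
    refine c'.continuousOn.comp ((continuousOn_embInv hj.isEmbedding).mono (image_subset_range _ _)) ?_
    rintro _ ⟨x', hx', rfl⟩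
    rwa [embInv_apply hj.injective]
  continuousOn_symm := hj.continuous.comp_continuousOn c'.continuousOn_symm
  mem_source := ⟨b, c'.mem_source, rfl⟩
  apply_eq_zero := by
    change c'.e (embInv j (j b)) = 0
    rw [embInv_apply hj.injective, c'.apply_eq_zero]
  pos := c'.pos
  target_subset := c'.target_subset
  subset_target := c'.subset_target
  mem_iff := by
    rintro _ ⟨x', hx', rfl⟩ hball
    change c'.e (embInv j (j x')) ∈ closedBall (0 : ℝ × F) (4 * h) at hball
    change (j x' ∈ B ↔ (c'.e (embInv j (j x'))).1 = 0)
    rw [embInv_apply hj.injective] at hball ⊢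
    exact (hB x').symm.trans (c'.mem_iff x' hx' hball)

variable {j : X' → X} (hj : IsOpenEmbedding j) (hB : ∀ x', x' ∈ B' ↔ j x' ∈ B)

/-- The chart of the pushforward on points of the image. [folklore] -/
theorem pushforward_apply (x' : X') : (c'.pushforward hj hB).e (j x') = c'.e x' := by
  change c'.e (embInv j (j x')) = c'.e x'
  rw [embInv_apply hj.injective]

/-- The source of the pushforward is the image of the source. [folklore] -/
theorem pushforward_source : (c'.pushforward hj hB).e.source = j '' c'.e.source := rfl

/-- **The core of the pushforward is the image of the core.** [folklore] -/
theorem core_pushforward : (c'.pushforward hj hB).core = j '' c'.core := by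
  ext x
  constructor
  · rintro ⟨⟨x', hx', rfl⟩, hball⟩
    refine ⟨x', ⟨hx', ?_⟩, rfl⟩
    change (c'.pushforward hj hB).e (j x') ∈ ball ((h, 0) : ℝ × F) h at hball
    rw [pushforward_apply] at hball
    exact hball
  · rintro ⟨x', ⟨hx', hball⟩, rfl⟩
    refine ⟨⟨x', hx', rfl⟩, ?_⟩
    change (c'.pushforward hj hB).e (j x') ∈ ball ((h, 0) : ℝ × F) h
    rw [pushforward_apply]
    exact hball

/-- The centre of the pushforward is the image of the centre. [folklore] -/
theorem center_pushforward : (c'.pushforward hj hB).center = j c'.center := rfl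

/-- `j` is a map of pairs `(X', X' ∖ core c') → (X, X ∖ core (j_* c'))`. [folklore] -/
theorem mapsTo_compl_core : MapsTo j c'.coreᶜ (c'.pushforward hj hB).coreᶜ := by
  intro x' hx' hx
  rw [core_pushforward] at hx
  obtain ⟨y, hy, hyx⟩ := hx
  exact hx' (hj.injective hyx ▸ hy)

/-- `j` restricted to the complements of the cores. [folklore] -/
abbrev jS : C(↥(c'.coreᶜ : Set X'), ↥((c'.pushforward hj hB).coreᶜ : Set X)) :=
  subsetRestrict ⟨j, hj.continuous⟩ (c'.mapsTo_compl_core hj hB)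

/-- `jS` is a map of pairs away from the base points. [folklore] -/
theorem mapsTo_jS : MapsTo (c'.jS hj hB) ({c'.pS}ᶜ : Set _) ({(c'.pushforward hj hB).pS}ᶜ : Set _) :=
  fun _ hx h' => hx (Subtype.ext (hj.injective (congrArg Subtype.val h')))

/-- `j` is a map of pairs at the centres. [folklore] -/
theorem mapsTo_center : MapsTo j ({c'.center}ᶜ : Set X') ({(c'.pushforward hj hB).center}ᶜ : Set X) :=
  fun _ hx h' => hx (hj.injective h')

/-- (N1) **Restriction to the centre commutes with `j_*`** on the classes along the cores. [folklore] -/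
theorem restrictToPoint_map_core (k : ℕ) (α : localHomologyOfSet R M X' c'.core k) :
    restrictToPoint R M (c'.pushforward hj hB).center_mem_core k
        (relativeSingularHomology.map R M ⟨j, hj.continuous⟩ (c'.mapsTo_compl_core hj hB) k α) =
      relativeSingularHomology.map R M ⟨j, hj.continuous⟩ (c'.mapsTo_center hj hB) k
        (restrictToPoint R M c'.center_mem_core k α) := by
  change (relativeSingularHomology.map R M _ _ k ≫ relativeSingularHomology.map R M _ _ k) α =
    (relativeSingularHomology.map R M _ _ k ≫ relativeSingularHomology.map R M _ _ k) α
  rw [← relativeSingularHomology.map_comp, ← relativeSingularHomology.map_comp]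
  rfl

/-- (N2) **`Φ` commutes with `j_*`**: `Φ_{j_* c'} (j_* α) = (j^S)_* (Φ_{c'} α)` (naturality of `∂`
and of the passage to local homology). [cite: HatcherAT2002, §2.1 (naturality of ∂)] -/
theorem Φ_map_core (n : ℕ) (α : localHomologyOfSet R M X' c'.core (n + 1)) :
    (c'.pushforward hj hB).Φ R M n
        (relativeSingularHomology.map R M ⟨j, hj.continuous⟩ (c'.mapsTo_compl_core hj hB) (n + 1) α) =
      relativeSingularHomology.map R M (c'.jS hj hB) (c'.mapsTo_jS hj hB) n (c'.Φ R M n α) := by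
  change singularHomology.toLocal R M _ n (relativeSingularHomology.δ R M X _ n
      (relativeSingularHomology.map R M ⟨j, hj.continuous⟩ (c'.mapsTo_compl_core hj hB) (n + 1) α)) =
    relativeSingularHomology.map R M (c'.jS hj hB) (c'.mapsTo_jS hj hB) n
      (singularHomology.toLocal R M _ n (relativeSingularHomology.δ R M X' _ n α))
  rw [← ModuleCat.comp_apply (relativeSingularHomology.map R M _ _ (n + 1)),
    ← relativeSingularHomology.δ_naturality, ModuleCat.comp_apply,
    singularHomology.toLocal_map_apply' R M (c'.jS hj hB) c'.pS _ (c'.mapsTo_jS hj hB)]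

/-- (N3) **`j_B` commutes with `j_*`**: `j_B (j|_{B'})_* β = (j^S)_* (j_{B'} β)`. [folklore] -/
theorem map_jB_map_bdryRestrict (hbB : b ∈ B') (k : ℕ)
    (β : localHomology R M ↥B' (⟨b, hbB⟩ : ↥B') k) :
    relativeSingularHomology.map R M (c'.pushforward hj hB).jB
        ((c'.pushforward hj hB).mapsTo_jB ((hB b).1 hbB)) k
        (relativeSingularHomology.map R M (bdryRestrict hj.continuous hB)
          (mapsTo_bdryRestrict hj.continuous hj.injective hB hbB) k β) =
      relativeSingularHomology.map R M (c'.jS hj hB) (c'.mapsTo_jS hj hB) k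
        (relativeSingularHomology.map R M c'.jB (c'.mapsTo_jB hbB) k β) := by
  rw [← ModuleCat.comp_apply, ← relativeSingularHomology.map_comp, ← ModuleCat.comp_apply,
    ← relativeSingularHomology.map_comp]
  rfl

end Pushforward

/-! ### The transfer at the centre and naturality of `(∂z)|ₚ` -/

section Transfer

variable [T2Space X'] [ProperSpace F] (c' : HalfChart B' b F h)

/-- **The boundary transfer of a half chart**: `Hₙ₊₁(X' | y) → Hₙ(B' | b)`, `y` the centre of the
core, the composite `j_{B'}⁻¹ ∘ Φ ∘ res_y⁻¹` of the chart's isomorphisms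
(`isIso_restrictToPoint_center`, `isIso_map_jB`). For a relative class `z'` of `(X', B')` it
carries `z'|_y` to `(∂z')|_b` (`transferAt_toLocal`). [cite: Spanier1981, Ch. 6 Sec. 3 Cor. 10] -/
def transferAt (hbB : b ∈ B') (n : ℕ) :
    localHomology R M X' c'.center (n + 1) ⟶ localHomology R M ↥B' (⟨b, hbB⟩ : ↥B') n :=
  haveI := c'.isIso_restrictToPoint_center R M (n + 1)
  haveI := c'.isIso_map_jB R M hbB n
  inv (restrictToPoint R M c'.center_mem_core (n + 1)) ≫ c'.Φ R M n ≫
    inv (relativeSingularHomology.map R M c'.jB (c'.mapsTo_jB hbB) n)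

/-- Defining property of the transfer: `j_{B'} (transferAt (res_y α)) = Φ α`. [folklore] -/
theorem map_jB_transferAt_restrictToPoint (hbB : b ∈ B') (n : ℕ)
    (α : localHomologyOfSet R M X' c'.core (n + 1)) :
    relativeSingularHomology.map R M c'.jB (c'.mapsTo_jB hbB) n
        (c'.transferAt R M hbB n (restrictToPoint R M c'.center_mem_core (n + 1) α)) =
      c'.Φ R M n α := by
  haveI := c'.isIso_restrictToPoint_center R M (n + 1)
  haveI := c'.isIso_map_jB R M hbB n
  rw [transferAt, ← ModuleCat.comp_apply, ← ModuleCat.comp_apply]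
  simp only [Category.assoc, IsIso.inv_hom_id, Category.comp_id, IsIso.hom_inv_id_assoc]

/-- **For a relative class of `(X', B')` itself the transfer gives `(∂z)|_b`**:
`transferAt (z|_y) = (∂z)|_b` (`HalfChart.Φ_coreClass`). [cite: Spanier1981, Ch. 6 Sec. 3 Cor. 10] -/
theorem transferAt_toLocal (hbB : b ∈ B') (n : ℕ) (z : relativeSingularHomology R M X' B' (n + 1)) :
    c'.transferAt R M hbB n
        (relativeSingularHomology.toLocal R M B' ⟨c'.center, c'.center_not_mem_B⟩ (n + 1) z) =
      singularHomology.toLocal R M ((⟨b, hbB⟩ : ↥B')) n (relativeSingularHomology.δ R M X' B' n z) := by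
  haveI := c'.isIso_map_jB R M hbB n
  apply (ModuleCat.mono_iff_injective
    (relativeSingularHomology.map R M c'.jB (c'.mapsTo_jB hbB) n)).1 inferInstance
  rw [← c'.restrictToPoint_coreClass R M n z c'.center_mem_core,
    map_jB_transferAt_restrictToPoint, Φ_coreClass]

/-- **Naturality of the boundary local class under an open embedding of pairs.** Let
`j : X' → X` be an open embedding with `j⁻¹(B) = B'`, `c'` a half chart of `(X', B')` at `b ∈ B'`
with centre `y`, and `z ∈ Hₙ₊₁(X, B; M)` a relative class whose local image at `j y` is `j_* ζ`.
Then `(∂z)|_{j b} = (j|_{B'})_* (transferAt c' ζ)`: the boundary local class of `z` at `j b` is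
computed inside `X'`. (Push the chart forward; `Φ`, restriction and `j_B` commute with `j_*`.)
[cite: HatcherAT2002, §3.3 p. 254 (∂[M] and locality)] -/
theorem toLocal_δ_eq_map_transferAt [Nonempty X'] [T2Space X] {j : X' → X} (hj : IsOpenEmbedding j)
    (hB : ∀ x', x' ∈ B' ↔ j x' ∈ B) (hbB : b ∈ B') (n : ℕ)
    (z : relativeSingularHomology R M X B (n + 1)) (ζ : localHomology R M X' c'.center (n + 1))
    (hz : relativeSingularHomology.toLocal R M B
        ⟨j c'.center, fun hjB => c'.center_not_mem_B ((hB _).2 hjB)⟩ (n + 1) z =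
      relativeSingularHomology.map R M ⟨j, hj.continuous⟩ (c'.mapsTo_center hj hB) (n + 1) ζ) :
    singularHomology.toLocal R M ((⟨j b, (hB b).1 hbB⟩ : ↥B)) n
        (relativeSingularHomology.δ R M X B n z) =
      relativeSingularHomology.map R M (bdryRestrict hj.continuous hB)
        (mapsTo_bdryRestrict hj.continuous hj.injective hB hbB) n (c'.transferAt R M hbB n ζ) := by
  -- the pushed chart `c = j_* c'` and its isomorphisms
  haveI i1 := (c'.pushforward hj hB).isIso_map_jB R M ((hB b).1 hbB) n
  haveI i2 := (c'.pushforward hj hB).isIso_restrictToPoint_center R M (n + 1)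
  haveI i3 := c'.isIso_restrictToPoint_center R M (n + 1)
  -- `ζ = res_y α'` for a class `α'` along the core of `c'`
  obtain ⟨α', rfl⟩ : ∃ α', restrictToPoint R M c'.center_mem_core (n + 1) α' = ζ :=
    ⟨inv (restrictToPoint R M c'.center_mem_core (n + 1)) ζ,
      by rw [← ModuleCat.comp_apply, IsIso.inv_hom_id, ModuleCat.id_apply]⟩
  -- `coreClass_c z = j_* α'` (both restrict to `j_* ζ` at the centre)
  have hcore : (c'.pushforward hj hB).coreClass R M n z =
      relativeSingularHomology.map R M ⟨j, hj.continuous⟩ (c'.mapsTo_compl_core hj hB) (n + 1) α' := by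
    apply (ModuleCat.mono_iff_injective
      (restrictToPoint R M (c'.pushforward hj hB).center_mem_core (n + 1))).1 inferInstance
    rw [(c'.pushforward hj hB).restrictToPoint_coreClass R M n z, restrictToPoint_map_core]
    exact hz
  -- compare after applying the injective `j_B` of the pushed chart
  apply (ModuleCat.mono_iff_injective (relativeSingularHomology.map R M (c'.pushforward hj hB).jB
    ((c'.pushforward hj hB).mapsTo_jB ((hB b).1 hbB)) n)).1 inferInstance
  rw [← (c'.pushforward hj hB).Φ_coreClass R M ((hB b).1 hbB) n z, hcore, Φ_map_core,
    map_jB_map_bdryRestrict, map_jB_transferAt_restrictToPoint]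

/-- **Boundary local classes agree along two open embeddings of the same pair.** For open
embeddings `jᵢ : (X', B') → (Xᵢ, Bᵢ)` (`jᵢ⁻¹(Bᵢ) = B'`), a half chart `c'` of `(X', B')` at `b`
with centre `y`, and relative classes `zᵢ ∈ Hₙ₊₁(Xᵢ, Bᵢ)` whose local images at `jᵢ y` come from
ONE class `ζ ∈ Hₙ₊₁(X' | y)`, the boundary local classes `(∂zᵢ)|_{jᵢ b}` come from ONE class
`β ∈ Hₙ(B' | b)`: `(∂zᵢ)|_{jᵢ b} = (jᵢ|_{B'})_* β`. [cite: HatcherAT2002, §3.3 p. 254 (∂[M] and locality)] -/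
theorem toLocal_δ_eq_of_two_embeddings [Nonempty X'] {X₁ X₂ : Type u} [TopologicalSpace X₁]
    [TopologicalSpace X₂] [T2Space X₁] [T2Space X₂] {B₁ : Set X₁} {B₂ : Set X₂}
    {j₁ : X' → X₁} {j₂ : X' → X₂} (hj₁ : IsOpenEmbedding j₁) (hj₂ : IsOpenEmbedding j₂)
    (hB₁ : ∀ x', x' ∈ B' ↔ j₁ x' ∈ B₁) (hB₂ : ∀ x', x' ∈ B' ↔ j₂ x' ∈ B₂) (hbB : b ∈ B') (n : ℕ)
    (z₁ : relativeSingularHomology R M X₁ B₁ (n + 1)) (z₂ : relativeSingularHomology R M X₂ B₂ (n + 1))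
    (ζ : localHomology R M X' c'.center (n + 1))
    (hz₁ : relativeSingularHomology.toLocal R M B₁
        ⟨j₁ c'.center, fun hjB => c'.center_not_mem_B ((hB₁ _).2 hjB)⟩ (n + 1) z₁ =
      relativeSingularHomology.map R M ⟨j₁, hj₁.continuous⟩ (c'.mapsTo_center hj₁ hB₁) (n + 1) ζ)
    (hz₂ : relativeSingularHomology.toLocal R M B₂
        ⟨j₂ c'.center, fun hjB => c'.center_not_mem_B ((hB₂ _).2 hjB)⟩ (n + 1) z₂ =
      relativeSingularHomology.map R M ⟨j₂, hj₂.continuous⟩ (c'.mapsTo_center hj₂ hB₂) (n + 1) ζ) :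
    ∃ β : localHomology R M ↥B' (⟨b, hbB⟩ : ↥B') n,
      singularHomology.toLocal R M ((⟨j₁ b, (hB₁ b).1 hbB⟩ : ↥B₁)) n
          (relativeSingularHomology.δ R M X₁ B₁ n z₁) =
        relativeSingularHomology.map R M (bdryRestrict hj₁.continuous hB₁)
          (mapsTo_bdryRestrict hj₁.continuous hj₁.injective hB₁ hbB) n β ∧
      singularHomology.toLocal R M ((⟨j₂ b, (hB₂ b).1 hbB⟩ : ↥B₂)) n
          (relativeSingularHomology.δ R M X₂ B₂ n z₂) =
        relativeSingularHomology.map R M (bdryRestrict hj₂.continuous hB₂)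
          (mapsTo_bdryRestrict hj₂.continuous hj₂.injective hB₂ hbB) n β :=
  ⟨c'.transferAt R M hbB n ζ, c'.toLocal_δ_eq_map_transferAt R M hj₁ hB₁ hbB n z₁ ζ hz₁,
    c'.toLocal_δ_eq_map_transferAt R M hj₂ hB₂ hbB n z₂ ζ hz₂⟩

end Transfer

end HalfChart

/-! ### The form for topological manifolds with boundary -/

section Manifold

variable {n : ℕ} {W' W₁ W₂ : Type u} [TopologicalSpace W'] [TopologicalSpace W₁] [TopologicalSpace W₂]
  [T2Space W'] [T2Space W₁] [T2Space W₂] [Nonempty W']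
  [ChartedSpace (EuclideanHalfSpace (n + 1)) W'] [ChartedSpace (EuclideanHalfSpace (n + 1)) W₁]
  [ChartedSpace (EuclideanHalfSpace (n + 1)) W₂]

/-- **Boundary local classes of relative classes agree along open embeddings of manifolds with
boundary**. Let `jᵢ : W' → Wᵢ` be open embeddings of topological `(n+1)`-manifolds with boundary
respecting the boundaries (`x ∈ ∂W' ↔ jᵢ x ∈ ∂Wᵢ`), `b ∈ ∂W'`, and `zᵢ ∈ Hₙ₊₁(Wᵢ, ∂Wᵢ; M)`. If
near `b` the local images of `z₁` and `z₂` at interior points correspond — precisely: at the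
centre `y` of every half chart at `b` they come from one class of `Hₙ₊₁(W' | y)` — then the
boundary local classes `(∂zᵢ)|_{jᵢ b} ∈ Hₙ(∂Wᵢ | jᵢ b)` come from one class of `Hₙ(∂W' | b)`. In
words: the boundary orientation induced by a relative fundamental class is local and natural
(Hatcher 2002, p. 254; Spanier Cor. 6.3.10), which makes "`b(W₁ ♮ W₂) = bW₁ # bW₂` as oriented
manifolds" (Kervaire–Milnor 1963, §2) a local check. Half charts at `b` exist
(`exists_halfChart_top`). [cite: HatcherAT2002, §3.3 p. 254 (∂[M] and locality)] -/
theorem toLocal_δ_eq_of_two_embeddings_manifold {b : W'} (hb : b ∈ (𝓡∂ (n + 1)).boundary W')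
    {j₁ : W' → W₁} {j₂ : W' → W₂} (hj₁ : IsOpenEmbedding j₁) (hj₂ : IsOpenEmbedding j₂)
    (hB₁ : ∀ x', x' ∈ (𝓡∂ (n + 1)).boundary W' ↔ j₁ x' ∈ (𝓡∂ (n + 1)).boundary W₁)
    (hB₂ : ∀ x', x' ∈ (𝓡∂ (n + 1)).boundary W' ↔ j₂ x' ∈ (𝓡∂ (n + 1)).boundary W₂)
    (z₁ : relativeSingularHomology R M W₁ ((𝓡∂ (n + 1)).boundary W₁) (n + 1))
    (z₂ : relativeSingularHomology R M W₂ ((𝓡∂ (n + 1)).boundary W₂) (n + 1))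
    (hloc : ∀ (h : ℝ) (c' : HalfChart ((𝓡∂ (n + 1)).boundary W') b (EuclideanSpace ℝ (Fin n)) h),
      ∃ ζ : localHomology R M W' c'.center (n + 1),
        relativeSingularHomology.toLocal R M ((𝓡∂ (n + 1)).boundary W₁)
            ⟨j₁ c'.center, fun hjB => c'.center_not_mem_B ((hB₁ _).2 hjB)⟩ (n + 1) z₁ =
          relativeSingularHomology.map R M ⟨j₁, hj₁.continuous⟩ (c'.mapsTo_center hj₁ hB₁) (n + 1) ζ ∧
        relativeSingularHomology.toLocal R M ((𝓡∂ (n + 1)).boundary W₂)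
            ⟨j₂ c'.center, fun hjB => c'.center_not_mem_B ((hB₂ _).2 hjB)⟩ (n + 1) z₂ =
          relativeSingularHomology.map R M ⟨j₂, hj₂.continuous⟩ (c'.mapsTo_center hj₂ hB₂) (n + 1) ζ) :
    ∃ β : localHomology R M ↥((𝓡∂ (n + 1)).boundary W') (⟨b, hb⟩ : ↥((𝓡∂ (n + 1)).boundary W')) n,
      singularHomology.toLocal R M ((⟨j₁ b, (hB₁ b).1 hb⟩ : ↥((𝓡∂ (n + 1)).boundary W₁))) n
          (relativeSingularHomology.δ R M W₁ _ n z₁) =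
        relativeSingularHomology.map R M (bdryRestrict hj₁.continuous hB₁)
          (mapsTo_bdryRestrict hj₁.continuous hj₁.injective hB₁ hb) n β ∧
      singularHomology.toLocal R M ((⟨j₂ b, (hB₂ b).1 hb⟩ : ↥((𝓡∂ (n + 1)).boundary W₂))) n
          (relativeSingularHomology.δ R M W₂ _ n z₂) =
        relativeSingularHomology.map R M (bdryRestrict hj₂.continuous hB₂)
          (mapsTo_bdryRestrict hj₂.continuous hj₂.injective hB₂ hb) n β := by
  obtain ⟨h, ⟨c'⟩⟩ := exists_halfChart_top (n := n) hb
  obtain ⟨ζ, hz₁, hz₂⟩ := hloc h c'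
  exact c'.toLocal_δ_eq_of_two_embeddings R M hj₁ hj₂ hB₁ hB₂ hb n z₁ z₂ ζ hz₁ hz₂

end Manifold

end Literature.AlgebraicTopology.SingularHomology
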